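import Mathlib.Analysis.SpecialFunctions.Integrals.Basic
import Mathlib.MeasureTheory.Integral.IntervalIntegral.Periodic
import Literature.Probability.LatticeModels.FejerKernel

/-!
# YM-DAG node N19 (= NE7 proper) — THE FEJÉR MEAN OF A PERIODIC LIPSCHITZ FUNCTION
# (a trigonometric polynomial with modes `|n − m|`, `n, m < L`, within `Λπ(1 + log L)∕L`, with the SAME Lipschitz constant)

Cell `pub-ymgap`, HUMAN RULING D-0062 (Track A) ∕ D-0149 (work-bound push), R141 (C) wider-strategy seat `pub-ymgap-dag-n19-e` (strategy
s3 = ALTERNATIVE CURRENCY), generation g33, module 2 (lineage module 150).  Route `Summits/QuantumFields/YangMills/Theses/BalabanUVNodes.lean`,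
cluster item K3⁸ «SpineGivenEndpointR13SepCoPHV» (stmt-QuantumFields-27366); filed `--supports` that item `--as helper` (it proves no registered
stub).  COUNT-NEUTRAL: [folklore] one-dimensional harmonic analysis over Mathlib (`intervalIntegral`, `Function.Periodic.intervalIntegral_add_eq`,
`integral_inv_of_pos`) and, BY NAME, `Literature.Probability.LatticeModels.FejerKernel` (`fejerKernel L u = ‖Σ_{n<L}e^{inu}‖²∕L`, `fejerKernel_nonneg`,
`fejerKernel_le` (`≤ L`), `fejerKernel_le_div_sq` (`≤ π²∕(Lu²)`)); no laws, no scheme object, no Theses import; NOT a discharge claim.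

ROLE IN THE LINEAGE.  PART 1 of the smoothing step of the SMOOTHED-LINK FIRST-ORDER LAW (module 151 `…N19SmoothLinkFirstOrder`): a Lipschitz link
must be replaced by a TRIGONOMETRIC polynomial `g` whose two polynomially-priced errors (`C^{1,1}` constant and `sup|g′|`) are controlled by the
LIPSCHITZ CONSTANT of the link, not by its coefficients.  The Fejér mean does the first half: for `f` `Λ`-Lipschitz and `2π`-periodic on `ℝ`,
`T(θ) = (1∕2π)∫_{−π}^{π} f(θ − v)f_L(v)dv` is (§2) a trigonometric polynomial with modes `ω_{nm} = |n − m|` (`n, m < L`), explicit coefficients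
`C_{nm} = ∫f cos(ω_{nm}·)`, `S_{nm} = ∫f sin(ω_{nm}·)` of size `≤ 2π sup|f|`, within `Λπ(1 + log L)∕L` of `f` EVERYWHERE (§1: `∫_{−π}^{π}|v|f_L(v)dv
≤ 2π²(1 + log L)∕L` from `f_L ≤ L` on `|v| ≤ π∕L` and `f_L ≤ π²∕(Lv²)` beyond), and `Λ`-LIPSCHITZ (positive kernel of mass `2π`).  PART 2
(`…N19FejerSteklovSmoothing`) box-averages `T` (`g = (1∕2δ)∫_{·−δ}^{·+δ}T`, so `g′ = (T(·+δ) − T(·−δ))∕2δ` explicitly: `|g′| ≤ Λ`, `g′` `(Λ∕δ)`-Lipschitz).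
§1 the kernel: `fejerKernel_eq_doubleSum` (`f_L(v) = (1∕L)Σ_{n,m<L}cos(|n−m|v)`), `integral_cos_natMul`, `integral_fejerKernel` (`= 2π`),
`continuous_fejerKernel`, `fejerKernel_neg`, `integral_abs_mul_fejerKernel_le`; §2 the mean: `integral_shift_cos_natMul` (one mode of the convolution),
`fejerMean_eq_trigSum`, `abs_fejerMean_sub_le`, `abs_fejerMean_sub_fejerMean_le`, `abs_fourierCoeff_le`.

HONEST FRAMING (binding).  Elementary and [folklore] (Fejér 1904 ∕ Lebesgue-constant bookkeeping; the `log L` is the Fejér kernel's, a Jackson kernel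
would remove it); NO consumer in the DAG today (a step of an optimality map of the seat's own currency, degree model); nothing of Bałaban's
instantiated; NE7 NOT PRINTED, NOT proved; N19 NOT discharged; count-neutral.  One finite `T⁴` programme at fixed `ε`; nothing continuum ∕ `ℝ⁴` ∕ OS ∕
mass-gap ∕ Clay.  0 `def` ∕ 0 `sorry`.
-/

noncomputable section

open Finset MeasureTheory intervalIntegral
open scoped Real

namespace Summit.QuantumFields.YangMills.Theorems.BalabanUVNodesN19FejerMean

open Literature.Probability.LatticeModels (fejerKernel dirichletSum fejerKernel_nonneg fejerKernel_le fejerKernel_le_div_sq)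

/-! ## §1 The Fejér kernel as a double cosine sum; mass, symmetry, first absolute moment [folklore] -/

/-- The mode `|n − m|` as a real number: `((n − m).natAbs : ℝ) = |n − m|`. [bookkeeping] -/
theorem cast_natAbs_sub (n m : ℕ) : ((((n : ℤ) - m).natAbs : ℕ) : ℝ) = |(n : ℝ) - m| := by
  rw [Nat.cast_natAbs]; push_cast; rfl

/-- `cos(|n − m|v) = cos(nv − mv)`. [bookkeeping] -/
theorem cos_natAbs_mul (n m : ℕ) (v : ℝ) :
    Real.cos ((((n : ℤ) - m).natAbs : ℕ) * v) = Real.cos (n * v - m * v) := by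
  rw [cast_natAbs_sub]
  rcases abs_choice ((n : ℝ) - m) with h | h
  · rw [h, sub_mul]
  · rw [h, neg_mul, Real.cos_neg, sub_mul]

/-- **THE FEJÉR KERNEL AS A DOUBLE COSINE SUM**: `f_L(v) = (1∕L)·Σ_{n<L}Σ_{m<L} cos(|n − m|·v)`
(`‖Σ_n e^{inv}‖² = (Σ_n cos nv)² + (Σ_n sin nv)² = Σ_{n,m}cos((n − m)v)`). [folklore] -/
theorem fejerKernel_eq_doubleSum (L : ℕ) (v : ℝ) :
    fejerKernel L v = (∑ n ∈ range L, ∑ m ∈ range L, Real.cos ((((n : ℤ) - m).natAbs : ℕ) * v)) / L := by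
  unfold fejerKernel
  congr 1
  have hre : (dirichletSum L v).re = ∑ n ∈ range L, Real.cos (n * v) := by
    unfold dirichletSum
    rw [Complex.re_sum]
    refine Finset.sum_congr rfl fun n _ => ?_
    rw [show ((n : ℝ) : ℂ) * v * Complex.I = ((n * v : ℝ) : ℂ) * Complex.I by push_cast; ring, Complex.exp_ofReal_mul_I_re]
  have him : (dirichletSum L v).im = ∑ n ∈ range L, Real.sin (n * v) := by
    unfold dirichletSum
    rw [Complex.im_sum]
    refine Finset.sum_congr rfl fun n _ => ?_
    rw [show ((n : ℝ) : ℂ) * v * Complex.I = ((n * v : ℝ) : ℂ) * Complex.I by push_cast; ring, Complex.exp_ofReal_mul_I_im]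
  rw [Complex.sq_norm, Complex.normSq_apply, hre, him]
  simp only [cos_natAbs_mul, Real.cos_sub, Finset.sum_add_distrib, Finset.sum_mul_sum]

/-- `∫_{−π}^{π} cos(kv) dv = 2π·[k = 0]` for a natural `k`. [folklore] -/
theorem integral_cos_natMul (k : ℕ) :
    ∫ v in (-π)..π, Real.cos (k * v) = if k = 0 then 2 * π else 0 := by
  split_ifs with hk
  · subst hk; simp; ring
  · have hc : (k : ℝ) ≠ 0 := by exact_mod_cast hk
    rw [intervalIntegral.integral_comp_mul_left (fun s => Real.cos s) hc, integral_cos]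
    simp only [smul_eq_mul, mul_neg, Real.sin_neg, sub_neg_eq_add]
    rw [Real.sin_nat_mul_pi]
    simp

/-- THE MASS OF THE FEJÉR KERNEL: `∫_{−π}^{π} f_L = 2π` (`L ≥ 1`). [folklore] -/
theorem integral_fejerKernel {L : ℕ} (hL : 1 ≤ L) : ∫ v in (-π)..π, fejerKernel L v = 2 * π := by
  have hLr : (L : ℝ) ≠ 0 := by exact_mod_cast (show L ≠ 0 by omega)
  have hint : ∀ n m : ℕ, IntervalIntegrable (fun v : ℝ => Real.cos ((((n : ℤ) - m).natAbs : ℕ) * v)) volume (-π) π :=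
    fun n m => (by fun_prop : Continuous fun v : ℝ => Real.cos ((((n : ℤ) - m).natAbs : ℕ) * v)).intervalIntegrable _ _
  simp_rw [fejerKernel_eq_doubleSum]
  have hint' : ∀ n : ℕ, IntervalIntegrable (fun v : ℝ => ∑ m ∈ range L, Real.cos ((((n : ℤ) - m).natAbs : ℕ) * v)) volume (-π) π :=
    fun n => (by fun_prop : Continuous fun v : ℝ => ∑ m ∈ range L, Real.cos ((((n : ℤ) - m).natAbs : ℕ) * v)).intervalIntegrable _ _
  rw [intervalIntegral.integral_div, intervalIntegral.integral_finsetSum fun (n : ℕ) _ => hint' n]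
  rw [Finset.sum_congr rfl fun (n : ℕ) _ => intervalIntegral.integral_finsetSum fun (m : ℕ) _ => hint n m]
  simp_rw [integral_cos_natMul]
  have hdiag : ∀ n ∈ range L, ∑ m ∈ range L, (if ((n : ℤ) - m).natAbs = 0 then 2 * π else 0) = 2 * π := by
    intro n hn
    rw [Finset.sum_eq_single n]
    · simp
    · intro m _ hmn
      rw [if_neg]
      intro h0
      apply hmn
      have : (n : ℤ) = m := by
        have := Int.natAbs_eq_zero.1 h0
        linarith
      exact_mod_cast this.symm
    · intro h; exact absurd hn h
  rw [Finset.sum_congr rfl hdiag, sum_const, card_range, nsmul_eq_mul]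
  field_simp

/-- The Fejér kernel is continuous. [bookkeeping] -/
theorem continuous_fejerKernel (L : ℕ) : Continuous fun v : ℝ => fejerKernel L v := by
  have : (fun v : ℝ => fejerKernel L v) =
      fun v => (∑ n ∈ range L, ∑ m ∈ range L, Real.cos ((((n : ℤ) - m).natAbs : ℕ) * v)) / L := by
    funext v; exact fejerKernel_eq_doubleSum L v
  rw [this]; fun_prop

/-- The Fejér kernel is even. [bookkeeping] -/
theorem fejerKernel_neg (L : ℕ) (v : ℝ) : fejerKernel L (-v) = fejerKernel L v := by
  rw [fejerKernel_eq_doubleSum, fejerKernel_eq_doubleSum]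
  simp only [mul_neg, Real.cos_neg]

/-- **THE FIRST ABSOLUTE MOMENT OF THE FEJÉR KERNEL**: `∫_{−π}^{π} |v|·f_L(v) dv ≤ 2π²(1 + log L)∕L` (`L ≥ 1`): `|v|f_L ≤ π` on `|v| ≤ π∕L`
(`f_L ≤ L`) and `|v|f_L(v) ≤ π²∕(L|v|)` beyond (`f_L ≤ π²∕(Lv²)`), `∫_{π∕L}^{π} dv∕v = log L`.  This `log L` is the Fejér kernel's (its Lebesgue
constant on Lipschitz functions); the Jackson kernel `f_L²∕‖f_L‖₂²` would give `O(1∕L)`. [folklore] -/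
theorem integral_abs_mul_fejerKernel_le {L : ℕ} (hL : 1 ≤ L) :
    ∫ v in (-π)..π, |v| * fejerKernel L v ≤ 2 * π ^ 2 * (1 + Real.log L) / L := by
  have hLr : (0 : ℝ) < L := by exact_mod_cast hL
  have hπ := Real.pi_pos
  set a : ℝ := π / L with ha
  have ha0 : 0 < a := div_pos hπ hLr
  have haπ : a ≤ π := by rw [ha, div_le_iff₀ hLr]; nlinarith [show (1 : ℝ) ≤ L by exact_mod_cast hL]
  have hcont : Continuous fun v : ℝ => |v| * fejerKernel L v := continuous_abs.mul (continuous_fejerKernel L)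
  have hii : ∀ b c : ℝ, IntervalIntegrable (fun v : ℝ => |v| * fejerKernel L v) volume b c := fun b c => hcont.intervalIntegrable _ _
  -- the middle piece
  have hmid : ∫ v in (-a)..a, |v| * fejerKernel L v ≤ 2 * π ^ 2 / L := by
    have h1 : ∫ v in (-a)..a, |v| * fejerKernel L v ≤ ∫ _v in (-a)..a, a * L := by
      refine intervalIntegral.integral_mono_on (by linarith) (hii _ _) (by simp) fun v hv => ?_
      exact mul_le_mul (abs_le.2 ⟨by linarith [hv.1], hv.2⟩) (fejerKernel_le L v) (fejerKernel_nonneg L v) ha0.le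
    rw [intervalIntegral.integral_const, smul_eq_mul] at h1
    have e : (a - -a) * (a * L) = 2 * π ^ 2 / L := by rw [ha]; field_simp; ring
    linarith [h1, e.le, e.ge]
  -- the right piece
  have hright : ∫ v in a..π, |v| * fejerKernel L v ≤ π ^ 2 * Real.log L / L := by
    have h1 : ∫ v in a..π, |v| * fejerKernel L v ≤ ∫ v in a..π, (π ^ 2 / L) * v⁻¹ := by
      refine intervalIntegral.integral_mono_on haπ (hii _ _) ?_ fun v hv => ?_
      · refine ContinuousOn.intervalIntegrable ?_
        refine ContinuousOn.mul continuousOn_const (continuousOn_inv₀.mono ?_)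
        intro v hv
        rw [Set.uIcc_of_le haπ] at hv
        exact ne_of_gt (ha0.trans_le hv.1)
      · have hv0 : 0 < v := ha0.trans_le hv.1
        have hd := fejerKernel_le_div_sq hL hv0.ne' (show |v| ≤ π by rw [abs_of_pos hv0]; exact hv.2)
        rw [abs_of_pos hv0]
        calc v * fejerKernel L v ≤ v * (π ^ 2 / (L * v ^ 2)) := mul_le_mul_of_nonneg_left hd hv0.le
          _ = (π ^ 2 / L) * v⁻¹ := by field_simp
    rw [intervalIntegral.integral_const_mul, integral_inv_of_pos ha0 hπ] at h1
    have e : π / a = L := by rw [ha]; field_simp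
    rw [e] at h1
    calc ∫ v in a..π, |v| * fejerKernel L v ≤ π ^ 2 / L * Real.log L := h1
      _ = π ^ 2 * Real.log L / L := by ring
  -- the left piece by symmetry
  have hleft : ∫ v in (-π)..(-a), |v| * fejerKernel L v ≤ π ^ 2 * Real.log L / L := by
    have e : ∫ v in (-π)..(-a), |v| * fejerKernel L v = ∫ v in a..π, |v| * fejerKernel L v := by
      rw [← intervalIntegral.integral_comp_neg fun v => |v| * fejerKernel L v]
      simp only [abs_neg, fejerKernel_neg]
    rw [e]; exact hright
  -- assemble
  have hsplit : ∫ v in (-π)..π, |v| * fejerKernel L v =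
      (∫ v in (-π)..(-a), |v| * fejerKernel L v) + ((∫ v in (-a)..a, |v| * fejerKernel L v) +
        ∫ v in a..π, |v| * fejerKernel L v) := by
    rw [intervalIntegral.integral_add_adjacent_intervals (hii _ _) (hii _ _),
      intervalIntegral.integral_add_adjacent_intervals (hii _ _) (hii _ _)]
  rw [hsplit]
  have e : 2 * π ^ 2 * (1 + Real.log L) / L = π ^ 2 * Real.log L / L + (2 * π ^ 2 / L + π ^ 2 * Real.log L / L) := by ring
  rw [e]
  exact add_le_add hleft (add_le_add hmid hright)

/-! ## §2 The Fejér mean of a periodic Lipschitz function [folklore] -/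

/-- **ONE MODE OF THE CONVOLUTION.**  For `f` continuous and `2π`-periodic and a natural frequency `k`:
`∫_{−π}^{π} f(θ − v)cos(kv) dv = cos(kθ)·∫_{−π}^{π} f(w)cos(kw) dw + sin(kθ)·∫_{−π}^{π} f(w)sin(kw) dw` (substitute `w = θ − v`, shift the window
back by periodicity, expand `cos(k(θ − w))`). [folklore] -/
theorem integral_shift_cos_natMul {f : ℝ → ℝ} (hfc : Continuous f) (hper : Function.Periodic f (2 * π)) (k : ℕ) (θ : ℝ) :
    ∫ v in (-π)..π, f (θ - v) * Real.cos (k * v) =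
      Real.cos (k * θ) * (∫ w in (-π)..π, f w * Real.cos (k * w)) + Real.sin (k * θ) * (∫ w in (-π)..π, f w * Real.sin (k * w)) := by
  -- substitute `w = θ − v`
  have hsub : ∫ v in (-π)..π, f (θ - v) * Real.cos (k * v) = ∫ w in (θ - π)..(θ + π), f w * Real.cos (k * (θ - w)) := by
    have h := intervalIntegral.integral_comp_sub_left (fun w => f w * Real.cos (k * (θ - w))) θ (a := -π) (b := π)
    simp only [sub_sub_cancel, sub_neg_eq_add] at h
    rw [← h]
  -- periodicity of the integrand
  have hperF : Function.Periodic (fun w => f w * Real.cos (k * (θ - w))) (2 * π) := by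
    intro w
    show f (w + 2 * π) * Real.cos (k * (θ - (w + 2 * π))) = f w * Real.cos (k * (θ - w))
    rw [hper w, show (k : ℝ) * (θ - (w + 2 * π)) = k * (θ - w) - k * (2 * π) by ring, Real.cos_sub_nat_mul_two_pi]
  have hshift : ∫ w in (θ - π)..(θ + π), f w * Real.cos (k * (θ - w)) = ∫ w in (-π)..π, f w * Real.cos (k * (θ - w)) := by
    have h := hperF.intervalIntegral_add_eq (θ - π) (-π)
    rw [show θ - π + 2 * π = θ + π by ring, show -π + 2 * π = π by ring] at h
    exact h
  rw [hsub, hshift]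
  -- expand `cos(k(θ − w))`
  have hexp : (fun w => f w * Real.cos (k * (θ - w))) =
      fun w => Real.cos (k * θ) * (f w * Real.cos (k * w)) + Real.sin (k * θ) * (f w * Real.sin (k * w)) := by
    funext w
    rw [mul_sub, Real.cos_sub]; ring
  have hi1 : IntervalIntegrable (fun w => Real.cos (k * θ) * (f w * Real.cos (k * w))) volume (-π) π :=
    ((by fun_prop : Continuous fun w => Real.cos (k * θ) * (f w * Real.cos (k * w))).intervalIntegrable _ _)
  have hi2 : IntervalIntegrable (fun w => Real.sin (k * θ) * (f w * Real.sin (k * w))) volume (-π) π :=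
    ((by fun_prop : Continuous fun w => Real.sin (k * θ) * (f w * Real.sin (k * w))).intervalIntegrable _ _)
  rw [hexp, intervalIntegral.integral_add hi1 hi2, intervalIntegral.integral_const_mul, intervalIntegral.integral_const_mul]

/-- **THE FEJÉR MEAN IS A TRIGONOMETRIC POLYNOMIAL WITH MODES `|n − m|`, `n, m < L`.**  For `f` continuous and `2π`-periodic:
`(1∕2π)∫_{−π}^{π} f(θ − v)f_L(v) dv = Σ_{n<L}Σ_{m<L} (1∕(2πL))·(C_{nm}cos(ω_{nm}θ) + S_{nm}sin(ω_{nm}θ))` with `ω_{nm} = |n − m|`,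
`C_{nm} = ∫_{−π}^{π} f(w)cos(ω_{nm}w) dw`, `S_{nm} = ∫_{−π}^{π} f(w)sin(ω_{nm}w) dw`. [folklore] -/
theorem fejerMean_eq_trigSum {f : ℝ → ℝ} (hfc : Continuous f) (hper : Function.Periodic f (2 * π)) (L : ℕ) (θ : ℝ) :
    (1 / (2 * π)) * ∫ v in (-π)..π, f (θ - v) * fejerKernel L v =
      ∑ n ∈ range L, ∑ m ∈ range L, (1 / (2 * π * L)) *
        ((∫ w in (-π)..π, f w * Real.cos ((((n : ℤ) - m).natAbs : ℕ) * w)) * Real.cos ((((n : ℤ) - m).natAbs : ℕ) * θ) +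
          (∫ w in (-π)..π, f w * Real.sin ((((n : ℤ) - m).natAbs : ℕ) * w)) * Real.sin ((((n : ℤ) - m).natAbs : ℕ) * θ)) := by
  have hfθ : Continuous fun v => f (θ - v) := hfc.comp (continuous_const.sub continuous_id)
  have hint : ∀ n m : ℕ, IntervalIntegrable (fun v : ℝ => f (θ - v) * Real.cos ((((n : ℤ) - m).natAbs : ℕ) * v)) volume (-π) π :=
    fun n m => (hfθ.mul (by fun_prop)).intervalIntegrable _ _
  have h1 : (fun v => f (θ - v) * fejerKernel L v) =
      fun v => (∑ n ∈ range L, ∑ m ∈ range L, f (θ - v) * Real.cos ((((n : ℤ) - m).natAbs : ℕ) * v)) / L := by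
    funext v
    rw [fejerKernel_eq_doubleSum, mul_div_assoc', Finset.mul_sum]
    congr 1
    exact Finset.sum_congr rfl fun n _ => Finset.mul_sum _ _ _
  have hint' : ∀ n : ℕ, IntervalIntegrable (fun v : ℝ =>
      ∑ m ∈ range L, f (θ - v) * Real.cos ((((n : ℤ) - m).natAbs : ℕ) * v)) volume (-π) π :=
    fun n => (continuous_finsetSum _ fun m _ => hfθ.mul (by fun_prop)).intervalIntegrable _ _
  rw [h1, intervalIntegral.integral_div, intervalIntegral.integral_finsetSum fun (n : ℕ) _ => hint' n]
  rw [Finset.sum_congr rfl fun (n : ℕ) _ => intervalIntegral.integral_finsetSum fun (m : ℕ) _ => hint n m]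
  simp_rw [integral_shift_cos_natMul hfc hper]
  rw [Finset.sum_div, Finset.mul_sum]
  refine Finset.sum_congr rfl fun n _ => ?_
  rw [Finset.sum_div, Finset.mul_sum]
  refine Finset.sum_congr rfl fun m _ => ?_
  rcases Nat.eq_zero_or_pos L with hL0 | hLpos
  · subst hL0; simp
  · have hLr : (L : ℝ) ≠ 0 := by exact_mod_cast hLpos.ne'
    field_simp

/-- **THE FEJÉR MEAN OF A LIPSCHITZ FUNCTION**: for `f` continuous, `2π`-periodic and `Λ`-Lipschitz on `ℝ` and `L ≥ 1`,
`|(1∕2π)∫_{−π}^{π} f(θ − v)f_L(v) dv − f(θ)| ≤ Λ·π(1 + log L)∕L` for every `θ` (mass `2π`, `|f(θ − v) − f(θ)| ≤ Λ|v|`, §1's first absolute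
moment). [folklore] -/
theorem abs_fejerMean_sub_le {f : ℝ → ℝ} {Λ : ℝ} (hfc : Continuous f) (hΛ : ∀ a b, |f a - f b| ≤ Λ * |a - b|)
    {L : ℕ} (hL : 1 ≤ L) (θ : ℝ) :
    |(1 / (2 * π)) * (∫ v in (-π)..π, f (θ - v) * fejerKernel L v) - f θ| ≤ Λ * (π * (1 + Real.log L) / L) := by
  have hπ := Real.pi_pos
  have hΛ0 : 0 ≤ Λ := by
    have := hΛ 1 0
    have h1 : 0 ≤ Λ * |(1 : ℝ) - 0| := (abs_nonneg _).trans this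
    simpa using h1
  have hfθ : Continuous fun v => f (θ - v) := hfc.comp (continuous_const.sub continuous_id)
  have hK := continuous_fejerKernel L
  have hI1 : IntervalIntegrable (fun v => f (θ - v) * fejerKernel L v) volume (-π) π := (hfθ.mul hK).intervalIntegrable _ _
  have hI2 : IntervalIntegrable (fun v => f θ * fejerKernel L v) volume (-π) π := (continuous_const.mul hK).intervalIntegrable _ _
  have hsub : ∫ v in (-π)..π, (f (θ - v) - f θ) * fejerKernel L v =
      (∫ v in (-π)..π, f (θ - v) * fejerKernel L v) - ∫ v in (-π)..π, f θ * fejerKernel L v := by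
    rw [← intervalIntegral.integral_sub hI1 hI2]
    exact intervalIntegral.integral_congr fun v _ => by ring
  have hc2 : ∫ v in (-π)..π, f θ * fejerKernel L v = f θ * (2 * π) := by
    rw [intervalIntegral.integral_const_mul, integral_fejerKernel hL]
  have hdiff : (1 / (2 * π)) * (∫ v in (-π)..π, f (θ - v) * fejerKernel L v) - f θ =
      (1 / (2 * π)) * ∫ v in (-π)..π, (f (θ - v) - f θ) * fejerKernel L v := by
    rw [hsub, hc2]; field_simp
  rw [hdiff, abs_mul, abs_of_pos (by positivity : (0 : ℝ) < 1 / (2 * π))]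
  have hbound : |∫ v in (-π)..π, (f (θ - v) - f θ) * fejerKernel L v| ≤ ∫ v in (-π)..π, Λ * (|v| * fejerKernel L v) := by
    rw [← Real.norm_eq_abs]
    refine intervalIntegral.norm_integral_le_of_norm_le (by linarith) (ae_of_all _ fun v _ => ?_)
      ((continuous_const.mul (continuous_abs.mul hK)).intervalIntegrable _ _)
    rw [Real.norm_eq_abs, abs_mul, abs_of_nonneg (fejerKernel_nonneg L v), ← mul_assoc]
    refine mul_le_mul_of_nonneg_right ?_ (fejerKernel_nonneg L v)
    have := hΛ (θ - v) θ
    rwa [show θ - v - θ = -v by ring, abs_neg] at this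
  rw [intervalIntegral.integral_const_mul] at hbound
  have hmom := integral_abs_mul_fejerKernel_le hL
  calc 1 / (2 * π) * |∫ v in (-π)..π, (f (θ - v) - f θ) * fejerKernel L v|
      ≤ 1 / (2 * π) * (Λ * (2 * π ^ 2 * (1 + Real.log L) / L)) := by
        refine mul_le_mul_of_nonneg_left (hbound.trans (mul_le_mul_of_nonneg_left hmom hΛ0)) (by positivity)
    _ = Λ * (π * (1 + Real.log L) / L) := by field_simp

/-- **THE FEJÉR MEAN KEEPS THE LIPSCHITZ CONSTANT** (positive kernel of mass `2π`): for `f` continuous and `Λ`-Lipschitz on `ℝ`, `L ≥ 1`,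
`|(1∕2π)∫f(a − v)f_L(v)dv − (1∕2π)∫f(b − v)f_L(v)dv| ≤ Λ|a − b|`. [folklore] -/
theorem abs_fejerMean_sub_fejerMean_le {f : ℝ → ℝ} {Λ : ℝ} (hfc : Continuous f) (hΛ : ∀ a b, |f a - f b| ≤ Λ * |a - b|)
    {L : ℕ} (hL : 1 ≤ L) (a b : ℝ) :
    |(1 / (2 * π)) * (∫ v in (-π)..π, f (a - v) * fejerKernel L v) -
        (1 / (2 * π)) * (∫ v in (-π)..π, f (b - v) * fejerKernel L v)| ≤ Λ * |a - b| := by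
  have hπ := Real.pi_pos
  have hK := continuous_fejerKernel L
  have hfa : IntervalIntegrable (fun v => f (a - v) * fejerKernel L v) volume (-π) π :=
    ((hfc.comp (continuous_const.sub continuous_id)).mul hK).intervalIntegrable _ _
  have hfb : IntervalIntegrable (fun v => f (b - v) * fejerKernel L v) volume (-π) π :=
    ((hfc.comp (continuous_const.sub continuous_id)).mul hK).intervalIntegrable _ _
  rw [← mul_sub, ← intervalIntegral.integral_sub hfa hfb, abs_mul, abs_of_pos (by positivity : (0 : ℝ) < 1 / (2 * π))]
  have hbound : |∫ v in (-π)..π, (f (a - v) * fejerKernel L v - f (b - v) * fejerKernel L v)| ≤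
      ∫ v in (-π)..π, (Λ * |a - b|) * fejerKernel L v := by
    rw [← Real.norm_eq_abs]
    refine intervalIntegral.norm_integral_le_of_norm_le (by linarith) (ae_of_all _ fun v _ => ?_)
      ((continuous_const.mul hK).intervalIntegrable _ _)
    rw [Real.norm_eq_abs, ← sub_mul, abs_mul, abs_of_nonneg (fejerKernel_nonneg L v)]
    refine mul_le_mul_of_nonneg_right ?_ (fejerKernel_nonneg L v)
    have := hΛ (a - v) (b - v)
    rwa [show a - v - (b - v) = a - b by ring] at this
  rw [intervalIntegral.integral_const_mul, integral_fejerKernel hL] at hbound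
  calc 1 / (2 * π) * |∫ v in (-π)..π, (f (a - v) * fejerKernel L v - f (b - v) * fejerKernel L v)|
      ≤ 1 / (2 * π) * (Λ * |a - b| * (2 * π)) := mul_le_mul_of_nonneg_left hbound (by positivity)
    _ = Λ * |a - b| := by field_simp

/-- THE COEFFICIENTS ARE BOUNDED BY THE SUP: `|∫_{−π}^{π} f(w)cos(kw) dw| ≤ 2π·M` and `|∫_{−π}^{π} f(w)sin(kw) dw| ≤ 2π·M` when `|f| ≤ M`.
[bookkeeping] -/
theorem abs_fourierCoeff_le {f : ℝ → ℝ} {M : ℝ} (hM : ∀ w, |f w| ≤ M) (k : ℝ) :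
    |∫ w in (-π)..π, f w * Real.cos (k * w)| ≤ 2 * π * M ∧ |∫ w in (-π)..π, f w * Real.sin (k * w)| ≤ 2 * π * M := by
  have hπ := Real.pi_pos
  have hM0 : 0 ≤ M := (abs_nonneg _).trans (hM 0)
  constructor
  · rw [← Real.norm_eq_abs]
    calc ‖∫ w in (-π)..π, f w * Real.cos (k * w)‖ ≤ M * |π - -π| :=
          intervalIntegral.norm_integral_le_of_norm_le_const fun w _ => by
            rw [Real.norm_eq_abs, abs_mul]
            exact (mul_le_mul (hM w) (Real.abs_cos_le_one _) (abs_nonneg _) hM0).trans_eq (mul_one _)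
      _ = 2 * π * M := by rw [sub_neg_eq_add, abs_of_pos (by positivity)]; ring
  · rw [← Real.norm_eq_abs]
    calc ‖∫ w in (-π)..π, f w * Real.sin (k * w)‖ ≤ M * |π - -π| :=
          intervalIntegral.norm_integral_le_of_norm_le_const fun w _ => by
            rw [Real.norm_eq_abs, abs_mul]
            exact (mul_le_mul (hM w) (Real.abs_sin_le_one _) (abs_nonneg _) hM0).trans_eq (mul_one _)
      _ = 2 * π * M := by rw [sub_neg_eq_add, abs_of_pos (by positivity)]; ring

end Summit.QuantumFields.YangMills.Theorems.BalabanUVNodesN19FejerMean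

end
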